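import Mathlib.Data.Nat.Choose.Basic
import Mathlib.Algebra.BigOperators.Intervals
import Mathlib.Algebra.Order.BigOperators.Group.Finset
import Mathlib.Tactic
import Summits.CriticalPhenomena.PercolationContinuityZ3.Theorems.PercNearOneGluingNoHeavyLowerTailCoreBlock
import Summits.CriticalPhenomena.PercolationContinuityZ3.Theorems.PercNearOneGluingNoHeavyLowerTailHypMoments
import Summits.CriticalPhenomena.PercolationContinuityZ3.Theorems.PercNearOneGluingNoHeavyLowerTailCoreCov
import Summits.CriticalPhenomena.PercolationContinuityZ3.Theorems.PercNearOneGluingNoHeavyLowerTailCoreMaster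
import HarnessLib

/-!
# The CORE LEMMA of THEOREM DF1 (fixed hit sets, integer anchors)

Support file for the Sahi / Conjecture-P programme of route `PercNearOneGluingNoHeavy`
(`--supports stmt-CriticalPhenomena-4575`, prover prim-l12-p5 gen 27; proof notes
`prim-l12-p5/CORE-g26.md` §3.1, §5 and `prim-l12-p5/PROOF-DF1-g26.md` §2–3).  No definitions, no named
facts, no sorries.

STATEMENT (note (3.1), §5.7).  Blocks `|U_b| = h_b + u_b = 2m_b - 1` (`m₁ = a+1`, `m₂ = c+1`), a hit set
of type `(h₁,h₂)`, `s ≥ 0` anchors with `h_b + s ≥ 1`, buffer `B(i) = C(h₁+h₂+2s-2, i+s-1)` (`0` if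
`i + s = 0`), `S(α,γ) = ∑_{i ≤ h₁, j ≤ h₂} C(h₁,i)C(u₁,α-i)·C(h₂,j)C(u₂,γ-j)·B(i+j)`.
**CORE LEMMA** (`core_lemma`): `(a+c+s)·S(a+1,c) ≤ (a+c+s+1)·S(a+1,c+1)`.  By Bernstein averaging it
yields the TP₂ property of `Γ(s+a+c)·E[1/Γ(s+K_{a,c})]` (CORE CLAIM) and, with `MixtureTP2`, THEOREM
DF1/DF1′ (mixed log-supermodularity of the two-block partition function of every single-type de Finetti
law `X(j,k) = θ(1-P^jQ^k)` with `s` sure points).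

PROOF (note §5), assembled from the landed pieces: `CoreMaster.master_abstract` (MASTER IDENTITY),
the own-buffer split (`guard_vandermonde`, `block_reindex`, `transfer`: the `W`-sums become sums over the
total head count `k` of products of the one-block sums of `CoreBlock` with `M_b = u_b+1`,
`L_b = h_b+s-1`, `w_b(x) = C(h_b, m_b-x)`), the one-block estimates of `CoreBlock` and
`CoreCov.core_abstract` ((B1)×(B1) + (B2) ⟹ `≥ 0`).
-/


namespace Summit.CriticalPhenomena.PercolationContinuityZ3.Theorems

namespace CoreLemma

open Finset

/-! ### Summation bookkeeping -/

/-- Extending a range by terms that vanish. -/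
theorem sum_range_extend (f : ℕ → ℝ) (A d : ℕ) (h : ∀ i, A < i → f i = 0) :
    ∑ i ∈ range (A + 1 + d), f i = ∑ i ∈ range (A + 1), f i := by
  rw [sum_range_add, sum_eq_zero (fun x _ => h (A + 1 + x) (by omega)), add_zero]

/-- Two ranges give the same sum if the summand vanishes beyond both. -/
theorem sum_range_eq_of_support (f : ℕ → ℝ) (A B : ℕ) (hA : ∀ i, A < i → f i = 0)
    (hB : ∀ i, B < i → f i = 0) :
    ∑ i ∈ range (A + 1), f i = ∑ i ∈ range (B + 1), f i := by
  rcases le_total A B with h | h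
  · obtain ⟨d, rfl⟩ : ∃ d, B = A + d := ⟨B - A, by omega⟩
    rw [show A + d + 1 = A + 1 + d by ring, sum_range_extend f A d hA]
  · obtain ⟨d, rfl⟩ : ∃ d, A = B + d := ⟨A - B, by omega⟩
    rw [show B + d + 1 = B + 1 + d by ring, sum_range_extend f B d hB]

/-! ### The own-buffer split (Vandermonde with guards) -/

/-- `∑_{k ≤ K} G(L₁,k,x)·G(L₂,K-k,y) = C(L₁+L₂, K-x-y)` (`0` if `x + y > K`): splitting the buffer
`Bin(L₁+L₂, ½)` into the two own buffers. -/
theorem guard_vandermonde (L₁ L₂ K x y : ℕ) :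
    ∑ k ∈ range (K + 1), (if x ≤ k then (L₁.choose (k - x) : ℝ) else 0) *
        (if y ≤ K - k then (L₂.choose (K - k - y) : ℝ) else 0) =
      if x + y ≤ K then ((L₁ + L₂).choose (K - x - y) : ℝ) else 0 := by
  by_cases hxy : x + y ≤ K
  · rw [if_pos hxy]
    obtain ⟨r, hr⟩ : ∃ r, K = x + y + r := ⟨K - x - y, by omega⟩
    rw [show K + 1 = x + (r + 1 + y) by omega, sum_range_add]
    have hz : ∑ k ∈ range x, (if x ≤ k then (L₁.choose (k - x) : ℝ) else 0) *
        (if y ≤ K - k then (L₂.choose (K - k - y) : ℝ) else 0) = 0 := by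
      refine sum_eq_zero fun k hk => ?_
      have : k < x := mem_range.mp hk
      rw [if_neg (show ¬ (x ≤ k) by omega)]
      simp
    rw [hz, zero_add, sum_range_add]
    have hz2 : ∑ z ∈ range y, (if x ≤ x + (r + 1 + z) then (L₁.choose (x + (r + 1 + z) - x) : ℝ) else 0) *
        (if y ≤ K - (x + (r + 1 + z)) then (L₂.choose (K - (x + (r + 1 + z)) - y) : ℝ) else 0) = 0 := by
      refine sum_eq_zero fun z hz => ?_
      have : z < y := mem_range.mp hz
      rw [if_neg (show ¬ (y ≤ K - (x + (r + 1 + z))) by omega)]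
      simp
    rw [hz2, add_zero]
    have hmain : ∑ z ∈ range (r + 1), (if x ≤ x + z then (L₁.choose (x + z - x) : ℝ) else 0) *
        (if y ≤ K - (x + z) then (L₂.choose (K - (x + z) - y) : ℝ) else 0) =
        ∑ z ∈ range (r + 1), (L₁.choose z : ℝ) * (L₂.choose (r - z) : ℝ) := by
      refine sum_congr rfl fun z hz => ?_
      have : z ≤ r := by
        have := mem_range.mp hz
        omega
      rw [if_pos (show x ≤ x + z by omega), if_pos (show y ≤ K - (x + z) by omega),
        show x + z - x = z by omega, show K - (x + z) - y = r - z by omega]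
    rw [hmain, HypMoments.vandermonde, show K - x - y = r by omega]
  · rw [if_neg hxy]
    refine sum_eq_zero fun k hk => ?_
    have hkK : k ≤ K := by have := mem_range.mp hk; omega
    by_cases h1 : x ≤ k
    · rw [if_pos h1, if_neg (show ¬ (y ≤ K - k) by omega)]
      simp
    · rw [if_neg h1]
      simp

/-! ### Per-block reindexing `i = m - x` (hits drawn ↔ unhits drawn) -/

/-- One block: the sum over the hit count `i` of `C(h,i)·C(M,m-i)·φ(i)·G(L,k,m-i)` equals the sum
over the unhit count `x = m-i` of `C(M,x)·G(L,k,x)·w(x)·ψ(x)` with `w(x) = C(h,m-x)`, `ψ(x) = φ(m-x)`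
(a pure reindexing; in the note `M = u+1`, `h + u + 1 = 2m`). -/
theorem block_reindex (h m M L k : ℕ)
    (φ ψ w : ℕ → ℝ) (hw : ∀ x, w x = if x ≤ m then (h.choose (m - x) : ℝ) else 0)
    (hψ : ∀ x, x ≤ m → ψ x = φ (m - x)) :
    ∑ i ∈ range (h + 1), (h.choose i : ℝ) * (if i ≤ m then (M.choose (m - i) : ℝ) else 0) * φ i *
        (if m - i ≤ k then (L.choose (k - (m - i)) : ℝ) else 0) =
      ∑ x ∈ range (M + 1), (M.choose x : ℝ) * (if x ≤ k then (L.choose (k - x) : ℝ) else 0) *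
        w x * ψ x := by
  have hL : ∑ i ∈ range (h + 1), (h.choose i : ℝ) * (if i ≤ m then (M.choose (m - i) : ℝ) else 0) *
        φ i * (if m - i ≤ k then (L.choose (k - (m - i)) : ℝ) else 0) =
      ∑ i ∈ range (m + 1), (h.choose i : ℝ) * (if i ≤ m then (M.choose (m - i) : ℝ) else 0) *
        φ i * (if m - i ≤ k then (L.choose (k - (m - i)) : ℝ) else 0) := by
    refine sum_range_eq_of_support _ h m (fun i hi => ?_) (fun i hi => ?_)
    · rw [Nat.choose_eq_zero_of_lt hi]
      simp
    · rw [if_neg (show ¬ (i ≤ m) by omega)]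
      simp
  have hR : ∑ x ∈ range (M + 1), (M.choose x : ℝ) * (if x ≤ k then (L.choose (k - x) : ℝ) else 0) *
        w x * ψ x =
      ∑ x ∈ range (m + 1), (M.choose x : ℝ) * (if x ≤ k then (L.choose (k - x) : ℝ) else 0) *
        w x * ψ x := by
    refine sum_range_eq_of_support _ M m (fun x hx => ?_) (fun x hx => ?_)
    · rw [Nat.choose_eq_zero_of_lt hx]
      simp
    · rw [hw x, if_neg (show ¬ (x ≤ m) by omega)]
      simp
  rw [hL, hR, ← sum_range_reflect (fun x => (M.choose x : ℝ) *
    (if x ≤ k then (L.choose (k - x) : ℝ) else 0) * w x * ψ x) (m + 1)]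
  refine sum_congr rfl fun i hi => ?_
  have him : i ≤ m := by have := mem_range.mp hi; omega
  simp only [add_tsub_cancel_right]
  rw [hw (m - i), if_pos (show m - i ≤ m by omega), hψ (m - i) (by omega),
    show m - (m - i) = i by omega, if_pos him]
  ring

/-! ### Transfer of the `W`-sums to the total-head-count variable `k` -/

/-- The `W`-weighted double sum of a product `φ₁(i)φ₂(j)` equals the sum over `k ≤ K = a+c+s+1` of the
product of the two one-block sums (`CoreBlock` shape, `M_b = u_b+1`, `L_b = h_b+s-1`,
`w_b(x) = C(h_b,m_b-x)`, `ψ_b(x) = φ_b(m_b-x)`). -/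
theorem transfer (a c h₁ u₁ h₂ u₂ s : ℕ)
    (hs₁ : 1 ≤ h₁ + s) (hs₂ : 1 ≤ h₂ + s) (φ₁ φ₂ ψ₁ ψ₂ w₁ w₂ : ℕ → ℝ)
    (hw₁ : ∀ x, w₁ x = if x ≤ a + 1 then (h₁.choose (a + 1 - x) : ℝ) else 0)
    (hw₂ : ∀ y, w₂ y = if y ≤ c + 1 then (h₂.choose (c + 1 - y) : ℝ) else 0)
    (hψ₁ : ∀ x, x ≤ a + 1 → ψ₁ x = φ₁ (a + 1 - x)) (hψ₂ : ∀ y, y ≤ c + 1 → ψ₂ y = φ₂ (c + 1 - y)) :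
    ∑ i ∈ range (h₁ + 1), ∑ j ∈ range (h₂ + 1),
      (h₁.choose i : ℝ) * (if i ≤ a + 1 then ((u₁ + 1).choose (a + 1 - i) : ℝ) else 0) *
        ((h₂.choose j : ℝ) * (if j ≤ c + 1 then ((u₂ + 1).choose (c + 1 - j) : ℝ) else 0)) *
        (if 1 ≤ i + j + s then ((h₁ + h₂ + 2 * s - 2).choose (i + j + s - 1) : ℝ) else 0) *
        (φ₁ i * φ₂ j) =
    ∑ k ∈ range (a + c + s + 1 + 1),
      (∑ x ∈ range (u₁ + 1 + 1), ((u₁ + 1).choose x : ℝ) *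
          (if x ≤ k then ((h₁ + s - 1).choose (k - x) : ℝ) else 0) * w₁ x * ψ₁ x) *
      (∑ y ∈ range (u₂ + 1 + 1), ((u₂ + 1).choose y : ℝ) *
          (if y ≤ a + c + s + 1 - k then ((h₂ + s - 1).choose (a + c + s + 1 - k - y) : ℝ) else 0) *
          w₂ y * ψ₂ y) := by
  set K := a + c + s + 1 with hK
  -- step 1: split the buffer
  have hstep1 : ∀ i ∈ range (h₁ + 1), ∀ j ∈ range (h₂ + 1),
      (h₁.choose i : ℝ) * (if i ≤ a + 1 then ((u₁ + 1).choose (a + 1 - i) : ℝ) else 0) *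
        ((h₂.choose j : ℝ) * (if j ≤ c + 1 then ((u₂ + 1).choose (c + 1 - j) : ℝ) else 0)) *
        (if 1 ≤ i + j + s then ((h₁ + h₂ + 2 * s - 2).choose (i + j + s - 1) : ℝ) else 0) *
        (φ₁ i * φ₂ j) =
      ∑ k ∈ range (K + 1),
        ((h₁.choose i : ℝ) * (if i ≤ a + 1 then ((u₁ + 1).choose (a + 1 - i) : ℝ) else 0) * φ₁ i *
          (if a + 1 - i ≤ k then ((h₁ + s - 1).choose (k - (a + 1 - i)) : ℝ) else 0)) *
        ((h₂.choose j : ℝ) * (if j ≤ c + 1 then ((u₂ + 1).choose (c + 1 - j) : ℝ) else 0) * φ₂ j *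
          (if c + 1 - j ≤ K - k then ((h₂ + s - 1).choose (K - k - (c + 1 - j)) : ℝ) else 0)) := by
    intro i _ j _
    by_cases hi : i ≤ a + 1
    · by_cases hj : j ≤ c + 1
      · -- the genuine case: Vandermonde
        have hV := guard_vandermonde (h₁ + s - 1) (h₂ + s - 1) K (a + 1 - i) (c + 1 - j)
        have hB : (if 1 ≤ i + j + s then ((h₁ + h₂ + 2 * s - 2).choose (i + j + s - 1) : ℝ) else 0) =
            (if a + 1 - i + (c + 1 - j) ≤ K then
              ((h₁ + s - 1 + (h₂ + s - 1)).choose (K - (a + 1 - i) - (c + 1 - j)) : ℝ) else 0) := by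
          by_cases g : 1 ≤ i + j + s
          · rw [if_pos g, if_pos (show a + 1 - i + (c + 1 - j) ≤ K by omega),
              show h₁ + s - 1 + (h₂ + s - 1) = h₁ + h₂ + 2 * s - 2 by omega,
              show K - (a + 1 - i) - (c + 1 - j) = i + j + s - 1 by omega]
          · rw [if_neg g, if_neg (show ¬ (a + 1 - i + (c + 1 - j) ≤ K) by omega)]
        rw [hB, ← hV, mul_sum, sum_mul]
        refine sum_congr rfl fun k _ => ?_
        ring
      · rw [if_neg hj]
        simp
    · rw [if_neg hi]
      simp
  rw [sum_congr rfl fun i hi => sum_congr rfl fun j hj => hstep1 i hi j hj]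
  -- step 2: bring the sum over k outside and factor
  rw [sum_congr rfl fun i _ => sum_comm, sum_comm]
  refine sum_congr rfl fun k _ => ?_
  rw [← sum_mul_sum]
  -- step 3: reindex each block
  rw [block_reindex h₁ (a + 1) (u₁ + 1) (h₁ + s - 1) k φ₁ ψ₁ w₁ hw₁ hψ₁,
    block_reindex h₂ (c + 1) (u₂ + 1) (h₂ + s - 1) (K - k) φ₂ ψ₂ w₂ hw₂ hψ₂]

/-! ### The tilt `w_b(x) = C(h_b, m_b - x)` -/

/-- The tilt `w(x) = C(h, a+1-x)` is symmetric about `(u+1)/2` when `h + u = 2a+1`. -/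
theorem w_symm (a h u : ℕ) (hn : h + u = 2 * a + 1) (w : ℕ → ℝ)
    (hw : ∀ x, w x = if x ≤ a + 1 then (h.choose (a + 1 - x) : ℝ) else 0) :
    ∀ x, x ≤ u + 1 → w x = w (u + 1 - x) := by
  intro x hx
  rw [hw x, hw (u + 1 - x)]
  by_cases h1 : x ≤ a + 1
  · rw [if_pos h1]
    by_cases h2 : a + 1 ≤ x + h
    · rw [if_pos (show u + 1 - x ≤ a + 1 by omega), show a + 1 - (u + 1 - x) = h - (a + 1 - x) by omega,
        Nat.choose_symm (by omega)]
    · rw [if_neg (show ¬ (u + 1 - x ≤ a + 1) by omega),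
        Nat.choose_eq_zero_of_lt (show h < a + 1 - x by omega)]
      simp
  · rw [if_neg h1, if_pos (show u + 1 - x ≤ a + 1 by omega),
      Nat.choose_eq_zero_of_lt (show h < a + 1 - (u + 1 - x) by omega)]
    simp

/-- The tilt is unimodal (nondecreasing up to the centre). -/
theorem w_uni (a h u : ℕ) (hn : h + u = 2 * a + 1) (w : ℕ → ℝ)
    (hw : ∀ x, w x = if x ≤ a + 1 then (h.choose (a + 1 - x) : ℝ) else 0) :
    ∀ x, 2 * x + 2 ≤ u + 1 → w x ≤ w (x + 1) := by
  intro x hx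
  rw [hw x, hw (x + 1), if_pos (show x ≤ a + 1 by omega), if_pos (show x + 1 ≤ a + 1 by omega),
    show a + 1 - (x + 1) = a - x by omega]
  exact_mod_cast HypergeomPeak.choose_le_choose_of_closer (L := h) (p₁ := a - x) (p₂ := a + 1 - x)
    (by omega) (by omega)

/-- The tilt is nonnegative. -/
theorem w_nonneg (a h : ℕ) (w : ℕ → ℝ)
    (hw : ∀ x, w x = if x ≤ a + 1 then (h.choose (a + 1 - x) : ℝ) else 0) : ∀ x, 0 ≤ w x := by
  intro x
  rw [hw x]
  split_ifs <;> positivity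

/-! ### The CORE LEMMA -/

/-- **CORE LEMMA (note §5, THEOREM; integer anchors `s ≥ 0` included).**  For block sizes
`n₁ = h₁ + u₁ = 2a+1`, `n₂ = h₂ + u₂ = 2c+1`, a hit set of type `(h₁,h₂)` and `s` anchors with
`h_b + s ≥ 1`, the fixed-hit-set sums `S(α,γ) = ∑_{i,j} C(h₁,i)C(u₁,α-i)·C(h₂,j)C(u₂,γ-j)·C(h+2s-2,i+j+s-1)`
satisfy `(a+c+s)·S(a+1,c) ≤ (a+c+s+1)·S(a+1,c+1)`.  ('Majority agreement': in the circle / fair-coin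
arc-colouring model with both blocks odd, red winning both blocks by one point is at least as likely
as the two blocks splitting their one-point majorities.)  Proof: MASTER IDENTITY, own-buffer split,
(B1) in each block, (B2), as in the note. -/
theorem core_lemma (a c h₁ u₁ h₂ u₂ s : ℕ) (hn₁ : h₁ + u₁ = 2 * a + 1) (hn₂ : h₂ + u₂ = 2 * c + 1)
    (hs₁ : 1 ≤ h₁ + s) (hs₂ : 1 ≤ h₂ + s) :
    ((a : ℝ) + c + s) * ∑ i ∈ range (h₁ + 1), ∑ j ∈ range (h₂ + 1),
        (h₁.choose i : ℝ) * (if i ≤ a + 1 then (u₁.choose (a + 1 - i) : ℝ) else 0) *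
          ((h₂.choose j : ℝ) * (if j ≤ c then (u₂.choose (c - j) : ℝ) else 0)) *
          (if 1 ≤ i + j + s then ((h₁ + h₂ + 2 * s - 2).choose (i + j + s - 1) : ℝ) else 0) ≤
    ((a : ℝ) + c + s + 1) * ∑ i ∈ range (h₁ + 1), ∑ j ∈ range (h₂ + 1),
        (h₁.choose i : ℝ) * (if i ≤ a + 1 then (u₁.choose (a + 1 - i) : ℝ) else 0) *
          ((h₂.choose j : ℝ) * (if j ≤ c + 1 then (u₂.choose (c + 1 - j) : ℝ) else 0)) *
          (if 1 ≤ i + j + s then ((h₁ + h₂ + 2 * s - 2).choose (i + j + s - 1) : ℝ) else 0) := by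
  -- the MASTER IDENTITY
  have hM := CoreMaster.master_abstract h₁ h₂ (fun i => (h₁.choose i : ℝ)) (fun j => (h₂.choose j : ℝ))
    (fun i => if i ≤ a + 1 then (u₁.choose (a + 1 - i) : ℝ) else 0)
    (fun i => if i ≤ a then (u₁.choose (a - i) : ℝ) else 0)
    (fun i => if i ≤ a + 1 then ((u₁ + 1).choose (a + 1 - i) : ℝ) else 0)
    (fun j => if j ≤ c + 1 then (u₂.choose (c + 1 - j) : ℝ) else 0)
    (fun j => if j ≤ c then (u₂.choose (c - j) : ℝ) else 0)
    (fun j => if j ≤ c + 1 then ((u₂ + 1).choose (c + 1 - j) : ℝ) else 0)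
    (fun i => if 1 ≤ i + s then ((h₁ + h₂ + 2 * s - 2).choose (i + s - 1) : ℝ) else 0)
    ((u₁ : ℝ) + 1) ((u₂ : ℝ) + 1) ((a : ℝ) + c + s)
    (fun i hi => CoreMaster.eta_reflect h₁ i hi) (fun j hj => CoreMaster.eta_reflect h₂ j hj)
    (fun i hi => CoreMaster.B_reflect (h₁ + h₂) s i (by omega) hi)
    (fun i hi => CoreMaster.p_reflect a h₁ u₁ i hn₁ hi) (fun i hi => CoreMaster.P_reflect a h₁ u₁ i hn₁ hi)
    (fun j hj => CoreMaster.p_reflect c h₂ u₂ j hn₂ hj) (fun j hj => CoreMaster.P_reflect c h₂ u₂ j hn₂ hj)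
    (fun i hi => CoreMaster.R2 a h₁ u₁ i ((a : ℝ) + c + s) hn₁ hi)
    (fun j _ => CoreMaster.R3 c h₂ u₂ j hn₂)
  -- the tilts
  set w₁ : ℕ → ℝ := fun x => if x ≤ a + 1 then (h₁.choose (a + 1 - x) : ℝ) else 0 with hw₁def
  set w₂ : ℕ → ℝ := fun y => if y ≤ c + 1 then (h₂.choose (c + 1 - y) : ℝ) else 0 with hw₂def
  have hw₁ : ∀ x, w₁ x = if x ≤ a + 1 then (h₁.choose (a + 1 - x) : ℝ) else 0 := fun x => rfl
  have hw₂ : ∀ y, w₂ y = if y ≤ c + 1 then (h₂.choose (c + 1 - y) : ℝ) else 0 := fun y => rfl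
  have hw₁sym := w_symm a h₁ u₁ hn₁ w₁ hw₁
  have hw₁uni := w_uni a h₁ u₁ hn₁ w₁ hw₁
  have hw₁pos := w_nonneg a h₁ w₁ hw₁
  have hw₂sym := w_symm c h₂ u₂ hn₂ w₂ hw₂
  have hw₂uni := w_uni c h₂ u₂ hn₂ w₂ hw₂
  have hw₂pos := w_nonneg c h₂ w₂ hw₂
  -- transfer of the two parts of the W-sum
  have hT1 := transfer a c h₁ u₁ h₂ u₂ s hs₁ hs₂ (fun _ => 1) (fun _ => 1) (fun _ => 1) (fun _ => 1)
    w₁ w₂ hw₁ hw₂ (fun _ _ => rfl) (fun _ _ => rfl)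
  have hT2 := transfer a c h₁ u₁ h₂ u₂ s hs₁ hs₂ (fun i => 2 * (i : ℝ) - h₁) (fun j => 2 * (j : ℝ) - h₂)
    (fun x => -(2 * (x : ℝ) - ((u₁ + 1 : ℕ) : ℝ))) (fun y => -(2 * (y : ℝ) - ((u₂ + 1 : ℕ) : ℝ)))
    w₁ w₂ hw₁ hw₂
    (fun x hx => by
      have hnr : (h₁ : ℝ) + u₁ = 2 * a + 1 := by exact_mod_cast hn₁
      push_cast [Nat.cast_sub hx]
      linarith)
    (fun y hy => by
      have hnr : (h₂ : ℝ) + u₂ = 2 * c + 1 := by exact_mod_cast hn₂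
      push_cast [Nat.cast_sub hy]
      linarith)
  simp only [mul_one] at hT1
  simp only [mul_neg, neg_mul, neg_neg, sum_neg_distrib] at hT2
  -- the abstract two-block inequality
  have e₁ : ((u₁ + 1 + (h₁ + s - 1) : ℕ) : ℝ) = ((u₁ + 1 : ℕ) : ℝ) + ((h₁ + s - 1 : ℕ) : ℝ) := by
    push_cast
    ring
  have e₂ : ((u₂ + 1 + (h₂ + s - 1) : ℕ) : ℝ) = ((u₂ + 1 : ℕ) : ℝ) + ((h₂ + s - 1 : ℕ) : ℝ) := by
    push_cast
    ring
  have hcore := CoreCov.core_abstract (u₁ + 1 + (h₁ + s - 1)) (u₂ + 1 + (h₂ + s - 1)) (a + c + s + 1)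
    (by omega) (by omega) (by omega) ((u₁ + 1 : ℕ) : ℝ) ((u₂ + 1 : ℕ) : ℝ) (by positivity) (by positivity)
    (fun k => ∑ x ∈ range (u₁ + 1 + 1), ((u₁ + 1).choose x : ℝ) *
      (if x ≤ k then ((h₁ + s - 1).choose (k - x) : ℝ) else 0) * w₁ x)
    (fun k => ∑ x ∈ range (u₁ + 1 + 1), ((u₁ + 1).choose x : ℝ) *
      (if x ≤ k then ((h₁ + s - 1).choose (k - x) : ℝ) else 0) * w₁ x * (2 * (x : ℝ) - ((u₁ + 1 : ℕ) : ℝ)))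
    (fun k => ∑ y ∈ range (u₂ + 1 + 1), ((u₂ + 1).choose y : ℝ) *
      (if y ≤ k then ((h₂ + s - 1).choose (k - y) : ℝ) else 0) * w₂ y)
    (fun k => ∑ y ∈ range (u₂ + 1 + 1), ((u₂ + 1).choose y : ℝ) *
      (if y ≤ k then ((h₂ + s - 1).choose (k - y) : ℝ) else 0) * w₂ y * (2 * (y : ℝ) - ((u₂ + 1 : ℕ) : ℝ)))
    (fun k => CoreBlock.F_nonneg (u₁ + 1) (h₁ + s - 1) w₁ hw₁pos k)
    (fun k hk => CoreBlock.F_eq_zero_of_lt (u₁ + 1) (h₁ + s - 1) w₁ k hk)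
    (fun k hk => CoreBlock.F_symm (u₁ + 1) (h₁ + s - 1) w₁ hw₁sym k hk)
    (fun k hk => by
      rw [e₁]
      exact CoreBlock.F_step (u₁ + 1) (h₁ + s - 1) w₁ hw₁sym hw₁uni k hk)
    (fun k hk => CoreBlock.Mo_eq_zero_of_lt (u₁ + 1) (h₁ + s - 1) w₁ k hk)
    (fun k hk => CoreBlock.Mo_odd (u₁ + 1) (h₁ + s - 1) w₁ hw₁sym k hk)
    (fun k hk => CoreBlock.Mo_nonneg (u₁ + 1) (h₁ + s - 1) w₁ hw₁sym hw₁pos k hk)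
    (fun k hk => by
      rw [e₁, ← sub_sub]
      exact CoreBlock.Mo_upper (u₁ + 1) (h₁ + s - 1) w₁ hw₁sym hw₁uni k hk)
    (fun k => CoreBlock.F_nonneg (u₂ + 1) (h₂ + s - 1) w₂ hw₂pos k)
    (fun k hk => CoreBlock.F_eq_zero_of_lt (u₂ + 1) (h₂ + s - 1) w₂ k hk)
    (fun k hk => CoreBlock.F_symm (u₂ + 1) (h₂ + s - 1) w₂ hw₂sym k hk)
    (fun k hk => by
      rw [e₂]
      exact CoreBlock.F_step (u₂ + 1) (h₂ + s - 1) w₂ hw₂sym hw₂uni k hk)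
    (fun k hk => CoreBlock.Mo_eq_zero_of_lt (u₂ + 1) (h₂ + s - 1) w₂ k hk)
    (fun k hk => CoreBlock.Mo_odd (u₂ + 1) (h₂ + s - 1) w₂ hw₂sym k hk)
    (fun k hk => CoreBlock.Mo_nonneg (u₂ + 1) (h₂ + s - 1) w₂ hw₂sym hw₂pos k hk)
    (fun k hk => by
      rw [e₂, ← sub_sub]
      exact CoreBlock.Mo_upper (u₂ + 1) (h₂ + s - 1) w₂ hw₂sym hw₂uni k hk)
  rw [← hT1, ← hT2] at hcore
  -- constants
  have hN : ((u₁ + 1 + (h₁ + s - 1) : ℕ) : ℝ) + ((u₂ + 1 + (h₂ + s - 1) : ℕ) : ℝ) - 1 =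
      2 * ((a : ℝ) + c + s) + 1 := by
    have e : u₁ + 1 + (h₁ + s - 1) + (u₂ + 1 + (h₂ + s - 1)) = 2 * (a + c + s) + 2 := by omega
    have e' : ((u₁ + 1 + (h₁ + s - 1) : ℕ) : ℝ) + ((u₂ + 1 + (h₂ + s - 1) : ℕ) : ℝ) =
        ((u₁ + 1 + (h₁ + s - 1) + (u₂ + 1 + (h₂ + s - 1)) : ℕ) : ℝ) := by push_cast; ring
    rw [e', e]
    push_cast
    ring
  rw [hN] at hcore
  -- split the W-sum of the MASTER IDENTITY into the two transferred parts
  have hsplit : ∑ i ∈ range (h₁ + 1), ∑ j ∈ range (h₂ + 1),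
      (h₁.choose i : ℝ) * (if i ≤ a + 1 then ((u₁ + 1).choose (a + 1 - i) : ℝ) else 0) *
        ((h₂.choose j : ℝ) * (if j ≤ c + 1 then ((u₂ + 1).choose (c + 1 - j) : ℝ) else 0)) *
        (if 1 ≤ i + j + s then ((h₁ + h₂ + 2 * s - 2).choose (i + j + s - 1) : ℝ) else 0) *
        (((u₁ : ℝ) + 1) * ((u₂ : ℝ) + 1) +
          (2 * ((a : ℝ) + c + s) + 1) * ((2 * (i : ℝ) - h₁) * (2 * (j : ℝ) - h₂))) =
      ((u₁ : ℝ) + 1) * ((u₂ : ℝ) + 1) * ∑ i ∈ range (h₁ + 1), ∑ j ∈ range (h₂ + 1),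
        (h₁.choose i : ℝ) * (if i ≤ a + 1 then ((u₁ + 1).choose (a + 1 - i) : ℝ) else 0) *
          ((h₂.choose j : ℝ) * (if j ≤ c + 1 then ((u₂ + 1).choose (c + 1 - j) : ℝ) else 0)) *
          (if 1 ≤ i + j + s then ((h₁ + h₂ + 2 * s - 2).choose (i + j + s - 1) : ℝ) else 0) +
      (2 * ((a : ℝ) + c + s) + 1) * ∑ i ∈ range (h₁ + 1), ∑ j ∈ range (h₂ + 1),
        (h₁.choose i : ℝ) * (if i ≤ a + 1 then ((u₁ + 1).choose (a + 1 - i) : ℝ) else 0) *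
          ((h₂.choose j : ℝ) * (if j ≤ c + 1 then ((u₂ + 1).choose (c + 1 - j) : ℝ) else 0)) *
          (if 1 ≤ i + j + s then ((h₁ + h₂ + 2 * s - 2).choose (i + j + s - 1) : ℝ) else 0) *
          ((2 * (i : ℝ) - h₁) * (2 * (j : ℝ) - h₂)) := by
    rw [mul_sum, mul_sum, ← sum_add_distrib]
    refine sum_congr rfl fun i _ => ?_
    rw [mul_sum, mul_sum, ← sum_add_distrib]
    refine sum_congr rfl fun j _ => ?_
    ring
  rw [hsplit] at hM
  -- conclude: 4(u₁+1)(u₂+1)·((ν+1)S₁₁ - νS₁₀) ≥ 0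
  have hpos : (0 : ℝ) < 4 * ((u₁ : ℝ) + 1) * ((u₂ : ℝ) + 1) := by positivity
  have hMc : ((u₁ + 1 : ℕ) : ℝ) * ((u₂ + 1 : ℕ) : ℝ) = ((u₁ : ℝ) + 1) * ((u₂ : ℝ) + 1) := by push_cast; ring
  rw [hMc] at hcore
  have key : 0 ≤ 4 * ((u₁ : ℝ) + 1) * ((u₂ : ℝ) + 1) *
      (((a : ℝ) + c + s + 1) * ∑ i ∈ range (h₁ + 1), ∑ j ∈ range (h₂ + 1),
          (h₁.choose i : ℝ) * (if i ≤ a + 1 then (u₁.choose (a + 1 - i) : ℝ) else 0) *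
            ((h₂.choose j : ℝ) * (if j ≤ c + 1 then (u₂.choose (c + 1 - j) : ℝ) else 0)) *
            (if 1 ≤ i + j + s then ((h₁ + h₂ + 2 * s - 2).choose (i + j + s - 1) : ℝ) else 0) -
        ((a : ℝ) + c + s) * ∑ i ∈ range (h₁ + 1), ∑ j ∈ range (h₂ + 1),
          (h₁.choose i : ℝ) * (if i ≤ a + 1 then (u₁.choose (a + 1 - i) : ℝ) else 0) *
            ((h₂.choose j : ℝ) * (if j ≤ c then (u₂.choose (c - j) : ℝ) else 0)) *
            (if 1 ≤ i + j + s then ((h₁ + h₂ + 2 * s - 2).choose (i + j + s - 1) : ℝ) else 0)) := by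
    rw [hM]
    linarith [hcore]
  have := nonneg_of_mul_nonneg_right key hpos
  linarith

end CoreLemma

end Summit.CriticalPhenomena.PercolationContinuityZ3.Theorems
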